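import Literature.Geometry.Kaehler.ComplexTorusHodgeGroupLieAlgebraAlgebraic
import Literature.Geometry.Kaehler.ComplexTorusHodgeLieAlgebraCommutativeDimension
import Literature.Geometry.Kaehler.ComplexTorusMumfordTateGroupHodgeCircle
import HarnessLib

/-!
# Bounds for `dim Hg(X)` (trunk `zdim`) through the dictionary `dim_ℝ 𝔥𝔤_ℝ = dim Hg(X)`:
# `0 < dim Hg(X) ≤ g(2g+1)`, `dim Hg(X) ≤ g` for CM ∕ commutative `Hg`, `dim Hg(X) ≥ 3` otherwise, `dim Hg(X) = 1 ⟺ MT(X) = h(ℂ^×)`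

Layer `Literature/Geometry/Kaehler`, namespace `Literature.Geometry.Kaehler.ComplexTorus`; lane `lit-hodgefound`
(Track 2 foundations library), Layer A4; prover seat `lit-hodgefound-p17` (generation 39, self-proposed row g39-#11).
The lane's analytic files bound `dim_ℝ 𝔥𝔤_ℝ` (`ComplexTorusHodgeLieAlgebraSymplecticDimension`: `≤ g(2g+1)`;
`…CartanPTrivial`: `𝔭 ≠ 0 ⟹ ≥ 3`, `≤ 2 ⟹` commutative ∕ CM; `…CommutativeDimension`: commutative ∕ compact ∕ CM `⟹ ≤ g`;
`…MumfordTateGroupHodgeCircle`: `= 1 ⟺ MT(X) = h(ℂ^×)`). With g39-#9b's `finrank_hodgeGroupLie_eq_zdim` each becomes a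
statement about the dimension `zdim` of the Zariski-connected algebraic group `Hg(X)(ℂ)` of the trunk, the currency of the
product theorems (`…_of_zdim_lt`, `hodgeGroupC_prod_eq_blockDiagProd_iff_zdim_eq_add`). THEOREMS ONLY (no definition, no
instance, no named fact; net debt 0); every analytic input is imported, not restated.

## What is proved

`zdim_hodgeGroupC_pos`; `IsRiemannForm.zdim_hodgeGroupC_le` ∕ `IsAbelianVariety.zdim_hodgeGroupC_le` (`≤ g(2g+1)`);
`three_le_zdim_hodgeGroupC_of_hodgeCartanP_ne_bot`, `hodgeCartanP_eq_bot_of_zdim_le_two`;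
`IsRiemannForm.three_le_zdim_hodgeGroupC_of_not_hodgeGroup_comm`, `IsRiemannForm.zdim_hodgeGroupC_le_of_hodgeGroup_comm`,
`IsRiemannForm.zdim_hodgeGroupC_le_of_isCompact_hodgeGroup`, `IsRiemannForm.zdim_hodgeGroupC_le_of_exists_comm_isReduced_le_endAlgRat`
(CM `⟹ dim Hg(X) ≤ g`) and its `IsAbelianVariety` form, `IsRiemannForm.three_le_zdim_hodgeGroupC_of_not_exists_comm_isReduced_le_endAlgRat`
(non-CM `⟹ dim Hg(X) ≥ 3`), `IsRiemannForm.exists_comm_isReduced_le_endAlgRat_of_zdim_le_two`,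
`IsAbelianVariety.hodgeGroup_comm_of_zdim_le_two`, `coe_mumfordTateGroup_eq_range_hodgeSGL_iff_zdim_eq_one`.

## References

* [GreenGriffithsKerr2012] M. Green, P. Griffiths, M. Kerr, *Mumford–Tate Groups and Domains* (2012), §V (V.4) (p. 154), §VII.G.
* [Lange2023AbelianVarietiesComplex] H. Lange, *Abelian Varieties over the Complex Numbers* (2023), §7.2.3 Prop. 7.2.6, §7.3.1.
* [Imai1976HodgeGroups] H. Imai, *On the Hodge groups of some abelian varieties*, Kodai Math. Sem. Rep. 27 (1976), §2.
* [Springer1998] T. A. Springer, *Linear Algebraic Groups*, 2nd ed. (1998), 1.8.1.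
* [GoodmanWallachGTM255] R. Goodman, N. R. Wallach, GTM 255 (2009), §1.4.4 Thm. 1.4.10.
-/

noncomputable section

open Matrix Module

namespace Literature.Geometry.Kaehler

namespace ComplexTorus

open Literature.NumberTheory.Automorphic (IsZConnected)

variable {ι : Type*} [Fintype ι] [DecidableEq ι] {E : Type*} [NormedAddCommGroup E] [NormedSpace ℂ E]
  (Φ : (ι → ℝ) ≃L[ℝ] E)

/-! ## §1 Absolute bounds -/

/-- **`dim Hg(X) > 0`** for `X ≠ 0` (`𝔥𝔤_ℝ ⊇ 𝔨 ∋ J`). [cite: GreenGriffithsKerr2012, §II.A (p. 46)] [cite: Springer1998, 1.8.1] -/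
theorem zdim_hodgeGroupC_pos [Nonempty ι] : 0 < (isZConnected_map_toGL_hodgeGroupC Φ).zdim := by
  rw [← finrank_hodgeGroupLie_eq_zdim]
  exact lt_of_lt_of_le (finrank_hodgeIsotropyLie_pos Φ) (finrank_hodgeIsotropyLie_le Φ)

variable {Φ} in
/-- **`dim Hg(X) ≤ g(2g+1) = dim Sp_{2g}`** for every polarised complex torus of dimension `g`.
[cite: Lange2023AbelianVarietiesComplex, §7.3.1, proof of Prop. 7.3.2] [cite: Springer1998, 1.8.1] -/
theorem IsRiemannForm.zdim_hodgeGroupC_le [FiniteDimensional ℂ E] {η : E [⋀^Fin 2]→L[ℝ] ℝ} (hη : IsRiemannForm Φ η) :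
    (isZConnected_map_toGL_hodgeGroupC Φ).zdim ≤ finrank ℂ E * (2 * finrank ℂ E + 1) := by
  rw [← finrank_hodgeGroupLie_eq_zdim]; exact hη.finrank_hodgeGroupLie_le

variable {Φ} in
/-- `dim Hg(X) ≤ g(2g+1)` for an abelian variety of dimension `g`. [cite: Lange2023AbelianVarietiesComplex, §7.3.1, proof of Prop. 7.3.2] -/
theorem IsAbelianVariety.zdim_hodgeGroupC_le [FiniteDimensional ℂ E] (hX : IsAbelianVariety Φ) :
    (isZConnected_map_toGL_hodgeGroupC Φ).zdim ≤ finrank ℂ E * (2 * finrank ℂ E + 1) := by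
  obtain ⟨η, hη⟩ := hX
  exact hη.zdim_hodgeGroupC_le

/-! ## §2 `𝔭 ≠ 0 ⟹ dim Hg(X) ≥ 3`; `dim Hg(X) ≤ 2 ⟹ 𝔭 = 0` -/

/-- **`𝔭 ≠ 0 ⟹ dim Hg(X) ≥ 3`** (an `𝔰𝔩₂`-triple through a non-zero `P ∈ 𝔭`). [cite: GreenGriffithsKerr2012, §V (V.4) (p. 154)] -/
theorem three_le_zdim_hodgeGroupC_of_hodgeCartanP_ne_bot [Nonempty ι] (h : hodgeCartanP Φ ≠ ⊥) :
    3 ≤ (isZConnected_map_toGL_hodgeGroupC Φ).zdim := by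
  rw [← finrank_hodgeGroupLie_eq_zdim]; exact three_le_finrank_hodgeGroupLie_of_hodgeCartanP_ne_bot Φ h

/-- `dim Hg(X) ≤ 2 ⟹ 𝔭 = 0` (i.e. `𝔥𝔤_ℝ = 𝔨 ∩ 𝔥𝔤_ℝ`). [cite: GreenGriffithsKerr2012, §V (V.4) (p. 154)] -/
theorem hodgeCartanP_eq_bot_of_zdim_le_two [Nonempty ι] (h : (isZConnected_map_toGL_hodgeGroupC Φ).zdim ≤ 2) :
    hodgeCartanP Φ = ⊥ :=
  hodgeCartanP_eq_bot_of_finrank_hodgeGroupLie_le_two Φ (by rwa [finrank_hodgeGroupLie_eq_zdim])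

/-! ## §3 Commutative ∕ compact ∕ CM Hodge groups: `dim Hg(X) ≤ g`; otherwise `dim Hg(X) ≥ 3` -/

variable {Φ} in
/-- **Non-commutative `Hg(X)(ℝ)` ⟹ `dim Hg(X) ≥ 3`** (polarised torus, `X ≠ 0`). [cite: GreenGriffithsKerr2012, §V (V.4) (p. 154)] -/
theorem IsRiemannForm.three_le_zdim_hodgeGroupC_of_not_hodgeGroup_comm [Nonempty ι] {η : E [⋀^Fin 2]→L[ℝ] ℝ}
    (hη : IsRiemannForm Φ η) (h : ¬ ∀ M ∈ hodgeGroup Φ, ∀ N ∈ hodgeGroup Φ, M * N = N * M) :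
    3 ≤ (isZConnected_map_toGL_hodgeGroupC Φ).zdim := by
  rw [← finrank_hodgeGroupLie_eq_zdim]; exact hη.three_le_finrank_hodgeGroupLie_of_not_hodgeGroup_comm h

variable {Φ} in
/-- **Commutative `Hg(X)(ℝ)` ⟹ `dim Hg(X) ≤ g`** ("`M_φ` is a torus" inside a maximal torus of `U(g)`).
[cite: GreenGriffithsKerr2012, §V (V.4) (p. 154)] -/
theorem IsRiemannForm.zdim_hodgeGroupC_le_of_hodgeGroup_comm [FiniteDimensional ℂ E] {η : E [⋀^Fin 2]→L[ℝ] ℝ}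
    (hη : IsRiemannForm Φ η) (h : ∀ M ∈ hodgeGroup Φ, ∀ N ∈ hodgeGroup Φ, M * N = N * M) :
    (isZConnected_map_toGL_hodgeGroupC Φ).zdim ≤ finrank ℂ E := by
  rw [← finrank_hodgeGroupLie_eq_zdim]; exact hη.finrank_hodgeGroupLie_le_of_hodgeGroup_comm h

variable {Φ} in
/-- Compact `Hg(X)(ℝ)` ⟹ `dim Hg(X) ≤ g`. [cite: GreenGriffithsKerr2012, §V (V.4) (p. 154)] [cite: Mostow1974StrongRigidity, §2.6] -/
theorem IsRiemannForm.zdim_hodgeGroupC_le_of_isCompact_hodgeGroup [FiniteDimensional ℂ E] {η : E [⋀^Fin 2]→L[ℝ] ℝ}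
    (hη : IsRiemannForm Φ η) (h : IsCompact (hodgeGroup Φ : Set (SpecialLinearGroup ι ℝ))) :
    (isZConnected_map_toGL_hodgeGroupC Φ).zdim ≤ finrank ℂ E := by
  rw [← finrank_hodgeGroupLie_eq_zdim]; exact hη.finrank_hodgeGroupLie_le_of_isCompact_hodgeGroup h

variable {Φ} in
/-- **CM-type ⟹ `dim Hg(X) ≤ g`**: if `End_ℚ(X)` contains a commutative semisimple subalgebra of rank `2g` then the Hodge
group is a torus of dimension at most `g`. [cite: Lange2023AbelianVarietiesComplex, §7.2.3 Prop. 7.2.6] [cite: GreenGriffithsKerr2012, §V (V.4) (p. 154)] -/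
theorem IsRiemannForm.zdim_hodgeGroupC_le_of_exists_comm_isReduced_le_endAlgRat [FiniteDimensional ℂ E]
    {η : E [⋀^Fin 2]→L[ℝ] ℝ} (hη : IsRiemannForm Φ η)
    (hCM : ∃ T : Subalgebra ℚ (Matrix ι ι ℚ), T ≤ endAlgRat Φ ∧ IsReduced T ∧ (∀ a ∈ T, ∀ b ∈ T, a * b = b * a) ∧
      finrank ℚ T = Fintype.card ι) :
    (isZConnected_map_toGL_hodgeGroupC Φ).zdim ≤ finrank ℂ E := by
  rw [← finrank_hodgeGroupLie_eq_zdim]; exact hη.finrank_hodgeGroupLie_le_of_exists_comm_isReduced_le_endAlgRat hCM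

variable {Φ} in
/-- CM-type abelian variety ⟹ `dim Hg(X) ≤ g`. [cite: Lange2023AbelianVarietiesComplex, §7.2.3 Prop. 7.2.6] -/
theorem IsAbelianVariety.zdim_hodgeGroupC_le_of_exists_comm_isReduced_le_endAlgRat [FiniteDimensional ℂ E]
    (hX : IsAbelianVariety Φ)
    (hCM : ∃ T : Subalgebra ℚ (Matrix ι ι ℚ), T ≤ endAlgRat Φ ∧ IsReduced T ∧ (∀ a ∈ T, ∀ b ∈ T, a * b = b * a) ∧
      finrank ℚ T = Fintype.card ι) :
    (isZConnected_map_toGL_hodgeGroupC Φ).zdim ≤ finrank ℂ E := by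
  obtain ⟨η, hη⟩ := hX
  exact hη.zdim_hodgeGroupC_le_of_exists_comm_isReduced_le_endAlgRat hCM

variable {Φ} in
/-- **Not of CM-type ⟹ `dim Hg(X) ≥ 3`** (polarised torus, `X ≠ 0`). [cite: Lange2023AbelianVarietiesComplex, §7.2.3 Prop. 7.2.6]
[cite: Imai1976HodgeGroups, §2 (p. 368)] -/
theorem IsRiemannForm.three_le_zdim_hodgeGroupC_of_not_exists_comm_isReduced_le_endAlgRat [Nonempty ι]
    {η : E [⋀^Fin 2]→L[ℝ] ℝ} (hη : IsRiemannForm Φ η)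
    (h : ¬ ∃ T : Subalgebra ℚ (Matrix ι ι ℚ), T ≤ endAlgRat Φ ∧ IsReduced T ∧ (∀ a ∈ T, ∀ b ∈ T, a * b = b * a) ∧
      finrank ℚ T = Fintype.card ι) :
    3 ≤ (isZConnected_map_toGL_hodgeGroupC Φ).zdim := by
  rw [← finrank_hodgeGroupLie_eq_zdim]; exact hη.three_le_finrank_hodgeGroupLie_of_not_exists_comm_isReduced_le_endAlgRat h

variable {Φ} in
/-- **`dim Hg(X) ≤ 2 ⟹ X` is of CM-type** (polarised torus, `X ≠ 0`). [cite: Lange2023AbelianVarietiesComplex, §7.2.3 Prop. 7.2.6]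
[cite: GreenGriffithsKerr2012, §V (V.4) (p. 154)] -/
theorem IsRiemannForm.exists_comm_isReduced_le_endAlgRat_of_zdim_le_two [Nonempty ι] {η : E [⋀^Fin 2]→L[ℝ] ℝ}
    (hη : IsRiemannForm Φ η) (h : (isZConnected_map_toGL_hodgeGroupC Φ).zdim ≤ 2) :
    ∃ T : Subalgebra ℚ (Matrix ι ι ℚ), T ≤ endAlgRat Φ ∧ IsReduced T ∧ (∀ a ∈ T, ∀ b ∈ T, a * b = b * a) ∧
      finrank ℚ T = Fintype.card ι :=
  hη.exists_comm_isReduced_le_endAlgRat_of_finrank_hodgeGroupLie_le_two (by rwa [finrank_hodgeGroupLie_eq_zdim])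

variable {Φ} in
/-- `dim Hg(X) ≤ 2 ⟹ Hg(X)(ℝ)` commutative (abelian variety, `X ≠ 0`). [cite: GreenGriffithsKerr2012, §V (V.4) (p. 154)] -/
theorem IsAbelianVariety.hodgeGroup_comm_of_zdim_le_two [Nonempty ι] (hX : IsAbelianVariety Φ)
    (h : (isZConnected_map_toGL_hodgeGroupC Φ).zdim ≤ 2) : ∀ M ∈ hodgeGroup Φ, ∀ N ∈ hodgeGroup Φ, M * N = N * M :=
  hX.hodgeGroup_comm_of_finrank_hodgeGroupLie_le_two (by rwa [finrank_hodgeGroupLie_eq_zdim])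

variable {Φ} in
/-- `dim Hg(X) ∈ {1, 2}` or `dim Hg(X) ≥ 3`, and in the first case `X` is of CM-type: the trichotomy-free form
`dim Hg(X) ≤ 2 ∨ 3 ≤ dim Hg(X)` needs no proof; recorded is the useful split **CM with `dim Hg ≤ g`, or `dim Hg ≥ 3`**.
[cite: Lange2023AbelianVarietiesComplex, §7.2.3 Prop. 7.2.6] [cite: GreenGriffithsKerr2012, §V (V.4) (p. 154)] -/
theorem IsRiemannForm.zdim_hodgeGroupC_le_or_three_le [FiniteDimensional ℂ E] [Nonempty ι] {η : E [⋀^Fin 2]→L[ℝ] ℝ}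
    (hη : IsRiemannForm Φ η) :
    (isZConnected_map_toGL_hodgeGroupC Φ).zdim ≤ finrank ℂ E ∨ 3 ≤ (isZConnected_map_toGL_hodgeGroupC Φ).zdim := by
  by_cases h : ∃ T : Subalgebra ℚ (Matrix ι ι ℚ), T ≤ endAlgRat Φ ∧ IsReduced T ∧ (∀ a ∈ T, ∀ b ∈ T, a * b = b * a) ∧
      finrank ℚ T = Fintype.card ι
  · exact Or.inl (hη.zdim_hodgeGroupC_le_of_exists_comm_isReduced_le_endAlgRat h)
  · exact Or.inr (hη.three_le_zdim_hodgeGroupC_of_not_exists_comm_isReduced_le_endAlgRat h)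

/-! ## §4 `dim Hg(X) = 1 ⟺ MT(X)(ℝ) = h(ℂ^×)` -/

/-- **`MT(X)(ℝ) = h(ℂ^×) ⟺ dim Hg(X) = 1`** (`X ≠ 0`). [cite: Imai1976HodgeGroups, §2 (p. 368)] [cite: GreenGriffithsKerr2012, §VII.G table (type (ix))] -/
theorem coe_mumfordTateGroup_eq_range_hodgeSGL_iff_zdim_eq_one [FiniteDimensional ℂ E] (hg : 0 < finrank ℂ E) :
    (mumfordTateGroup Φ : Set (GL ι ℝ)) = Set.range (hodgeSGL Φ) ↔ (isZConnected_map_toGL_hodgeGroupC Φ).zdim = 1 := by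
  rw [coe_mumfordTateGroup_eq_range_hodgeSGL_iff_finrank_hodgeGroupLie_eq_one Φ hg, finrank_hodgeGroupLie_eq_zdim]

end ComplexTorus

end Literature.Geometry.Kaehler

end
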